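import Literature.AlgebraicGeometry.Resolution.BlowupAlgebraPresentation
import Mathlib.RingTheory.RegularLocalRing.Polynomial
import HarnessLib

/-!
# [OURS · L1 W4.5(b) · EL♮] K-VERTEX-EXIT (chart `c`): at the K5-VERTEX the Σ-centre `V(c, y₂)` resolves the determinantal strict
# transform `𝒞 = {rk N ≤ 1}` — chart `c ≠ 0` of `Bl_{(c̄,ȳ₂)} 𝒞` is an affine `4`-space
# (crux `EquisingularLiftNat` = stmt-ResolutionOfSingularities-20038; K-∀n / K5-BMY lane, kill test #50)

HONEST FRAMING. OURS (cell res-hironaka, crux chain w45b, slot W4.5(b)); NOT a statement of any manuscript; replaces the role of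
NOTHING in the manuscript; AI-written, AI review is weaker than expert review. Helper `--supports stmt-ResolutionOfSingularities-20038
--as helper`. Object K-VERTEX-EXIT of res-L1-w45b-strat-1's STRATEGY-CENSUS v11 (sha16 6d78683fc4832623) §4 (N6.1 (a)(b)(d)) / §5 R2‴, model form.

THE MODEL (v10 N5.3 / v11 N6 set-up). After the `m = 1` companion touch at a point of `D ∩ Δ`, the chart `x₃` of the blown-up ambient is a
regular `6`-space with coordinates `(x₃, c, y₁, x₁, y₂, d)`, `ϖ = x₁y₁ − x₃d`, and the strict transform is the generic determinantal variety
`𝒞 = {rk N ≤ 1}`, `N = [[x₃, −c, y₁],[x₁, y₂, d]]`, with minors `m₁₂ = x₃y₂ + cx₁`, `m₁₃ = x₃d − y₁x₁ = −ϖ`, `m₂₃ = −cd − y₁y₂`; the K5-VERTEX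
`v_P` is the origin (bad, not very bad). The Σ-centre of N6.1 is `C′ = V(c, y₂)` (column 2); its trace on `𝒞` is `(c̄, ȳ₂)`.

THE THEOREM (N6.1 (b): «chart: `St(𝒞) = V(x₁ − x₃t, d − y₁t)` — REGULAR»; model form over any commutative ring `k`, here with the sign `t = ȳ₂/c̄`):
`ψ : k[x₃, c, y₁, t] → B_c := 𝒪_𝒞[(c̄, ȳ₂)/c̄]`, `t ↦ ȳ₂/c̄`, is a BIJECTION for `k` a domain (`ψc_bijective`); in `B_c` the graph relations
`x̄₁ = −x̄₃·t`, `d̄ = −ȳ₁·t` (`algebraMap_x₁_eq`, `algebraMap_d_eq`) and `ȳ₂ = c̄·t` hold; for a field `B_c` is a regular ring (`isRegularRing_Bc`).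
Proof: onto by the relations (from `m₁₂`, `m₂₃`) and `blowupAlgebra.eval_surjective`; injective by the left inverse
`Λ : 𝒪_𝒞[1/c̄] → k[x₃,c,y₁,t][1/c]`, `x₁ ↦ −x₃t`, `y₂ ↦ ct`, `d ↦ −y₁t` (kills all three minors). Chart `y₂` is the sequel file.
Coordinates: `X 0,…,X 5 = x₃, c, y₁, x₁, y₂, d` on `𝔸⁶`; `X 0,…,X 3 = x₃, c, y₁, t` on the model.

References: res-L1-w45b-strat-1 STRATEGY-CENSUS v11 N6.1; [StacksProject, Tags 052P/052Q/080E]; [GortzWedhorn2020, (13.19) p. 415].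
-/

set_option linter.dupNamespace false -- mandated namespace `Summit.<Summit>.<Problem>` of this single-conjunct summit

noncomputable section

universe u

open Literature.AlgebraicGeometry.Resolution MvPolynomial

namespace Summit.ResolutionOfSingularities.ResolutionOfSingularities.Cruxes.EquisingularLiftNat.Sections

namespace VertexExit

/-! ## Identities in any commutative ring -/

/-- `uε = 1`, `a u = −b v` ⇒ `a = −b·(vε)`. [folklore] -/
theorem rel_div {L : Type*} [CommRing L] (a b u v e : L) (he : u * e = 1) (h : a * u = -(b * v)) : a = -(b * (v * e)) := by
  calc a = a * (u * e) := by rw [he, mul_one]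
    _ = a * u * e := by ring
    _ = -(b * v) * e := by rw [h]
    _ = -(b * (v * e)) := by ring

/-- `uε = 1` ⇒ `v = u·(vε)`. [folklore] -/
theorem rel_mul {L : Type*} [CommRing L] (u v e : L) (he : u * e = 1) : v = u * (v * e) := by
  calc v = v * (u * e) := by rw [he, mul_one]
    _ = u * (v * e) := by ring

variable (k : Type u) [CommRing k]

/-- The minor `m₁₂ = x₃y₂ + cx₁` (coordinates `X 0,…,X 5 = x₃, c, y₁, x₁, y₂, d`). OURS bookkeeping. -/
def m₁₂ : MvPolynomial (Fin 6) k := X 0 * X 4 + X 1 * X 3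

/-- The minor `m₁₃ = x₃d − y₁x₁` (`= −ϖ` in the K5 model). OURS bookkeeping. -/
def m₁₃ : MvPolynomial (Fin 6) k := X 0 * X 5 - X 2 * X 3

/-- The minor `m₂₃ = −cd − y₁y₂`. OURS bookkeeping. -/
def m₂₃ : MvPolynomial (Fin 6) k := -(X 1 * X 5) - X 2 * X 4

/-- The ideal `I₂(N)` of `2×2` minors. OURS bookkeeping. -/
def minors : Ideal (MvPolynomial (Fin 6) k) := Ideal.span {m₁₂ k, m₁₃ k, m₂₃ k}

/-- `𝒪_𝒞 = k[x₃,c,y₁,x₁,y₂,d]/I₂(N)`, the generic determinantal variety `{rk N ≤ 1}`. OURS bookkeeping. -/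
abbrev OC : Type u := MvPolynomial (Fin 6) k ⧸ minors k

/-- `k[…] → 𝒪_𝒞`. OURS bookkeeping. -/
abbrev mkC : MvPolynomial (Fin 6) k →+* OC k := Ideal.Quotient.mk (minors k)

/-- The trace `(c̄, ȳ₂)` on `𝒞` of the Σ-centre `C′ = V(c, y₂)`. OURS bookkeeping. -/
def trc : Fin 2 → OC k := ![mkC k (X 1), mkC k (X 4)]

/-- The chart `B_c = 𝒪_𝒞[(c̄, ȳ₂)/c̄] ⊆ 𝒪_𝒞[1/c̄]`. OURS bookkeeping. -/
abbrev Bc : Subalgebra (OC k) (Localization.Away (trc k 0)) := blowupAlgebra (Ideal.span (Set.range (trc k))) (trc k 0)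

/-- The values of the model coordinates `x₃, c, y₁, t` in `B_c`: `x̄₃`, `c̄`, `ȳ₁`, `ȳ₂/c̄`. OURS bookkeeping. -/
def cvc : Fin 4 → Bc k :=
  ![algebraMap (OC k) (Bc k) (mkC k (X 0)), algebraMap (OC k) (Bc k) (mkC k (X 1)), algebraMap (OC k) (Bc k) (mkC k (X 2)),
    blowupAlgebra.frac (trc k) 0 1]

/-- **`ψ : k[x₃, c, y₁, t] → B_c`**, `t ↦ ȳ₂/c̄` (model coordinates `X 0,…,X 3 = x₃, c, y₁, t`). OURS bookkeeping. -/
def ψc : MvPolynomial (Fin 4) k →+* Bc k :=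
  MvPolynomial.eval₂Hom ((algebraMap (OC k) (Bc k)).comp ((mkC k).comp MvPolynomial.C)) (cvc k)

/-! ## The relations -/

/-- `m₁₂ = 0` in `𝒪_𝒞`: `x̄₁ c̄ = −x̄₃ ȳ₂`. [folklore] -/
theorem x₁_mul_c : mkC k (X 3) * mkC k (X 1) = -(mkC k (X 0) * mkC k (X 4)) := by
  rw [← map_mul, ← map_mul, ← map_neg, Ideal.Quotient.eq]
  refine Ideal.subset_span (Or.inl ?_)
  rw [m₁₂]; ring

/-- `m₂₃ = 0` in `𝒪_𝒞`: `d̄ c̄ = −ȳ₁ ȳ₂`. [folklore] -/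
theorem d_mul_c : mkC k (X 5) * mkC k (X 1) = -(mkC k (X 2) * mkC k (X 4)) := by
  rw [← map_mul, ← map_mul, ← map_neg, Ideal.Quotient.eq]
  have h : (X 5 * X 1 - -(X 2 * X 4) : MvPolynomial (Fin 6) k) = -m₂₃ k := by rw [m₂₃]; ring
  rw [h]
  exact (minors k).neg_mem (Ideal.subset_span (by simp))

/-- `c̄ · (1/c̄) = 1` in `𝒪_𝒞[1/c̄]`. [folklore] -/
theorem c_mul_invSelf :
    algebraMap (OC k) (Localization.Away (trc k 0)) (trc k 0) * IsLocalization.Away.invSelf (trc k 0) = 1 :=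
  IsLocalization.Away.mul_invSelf (S := Localization.Away (trc k 0)) (trc k 0)

/-- `ψ` on constants. [folklore] -/
theorem ψc_C (a : k) : ψc k (C a) = algebraMap (OC k) (Bc k) (mkC k (C a)) := MvPolynomial.eval₂Hom_C _ _ a

/-- `ψ x₃ = x̄₃`. [folklore] -/
theorem ψc_X₀ : ψc k (X 0) = algebraMap (OC k) (Bc k) (mkC k (X 0)) := MvPolynomial.eval₂Hom_X' _ _ 0

/-- `ψ c = c̄`. [folklore] -/
theorem ψc_X₁ : ψc k (X 1) = algebraMap (OC k) (Bc k) (mkC k (X 1)) := MvPolynomial.eval₂Hom_X' _ _ 1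

/-- `ψ y₁ = ȳ₁`. [folklore] -/
theorem ψc_X₂ : ψc k (X 2) = algebraMap (OC k) (Bc k) (mkC k (X 2)) := MvPolynomial.eval₂Hom_X' _ _ 2

/-- `ψ t = ȳ₂/c̄`. [folklore] -/
theorem ψc_X₃ : ψc k (X 3) = blowupAlgebra.frac (trc k) 0 1 := MvPolynomial.eval₂Hom_X' _ _ 3

/-- **N6.1 (b), first graph relation: `x̄₁ = −x̄₃·t` in `B_c`.** [folklore] -/
theorem algebraMap_x₁_eq : algebraMap (OC k) (Bc k) (mkC k (X 3)) = -(ψc k (X 0) * ψc k (X 3)) := by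
  rw [ψc_X₀, ψc_X₃]
  apply Subtype.ext
  rw [Subalgebra.coe_neg, Subalgebra.coe_mul, blowupAlgebra.coe_frac]
  refine rel_div _ _ _ _ _ (c_mul_invSelf k) ?_
  change algebraMap (OC k) (Localization.Away (trc k 0)) (mkC k (X 3)) * algebraMap (OC k) _ (mkC k (X 1)) =
    -(algebraMap (OC k) _ (mkC k (X 0)) * algebraMap (OC k) _ (mkC k (X 4)))
  rw [← map_mul (algebraMap (OC k) (Localization.Away (trc k 0))), ← map_mul (algebraMap (OC k) (Localization.Away (trc k 0))),
    ← map_neg (algebraMap (OC k) (Localization.Away (trc k 0))), x₁_mul_c]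

/-- **N6.1 (b), second graph relation: `d̄ = −ȳ₁·t` in `B_c`.** [folklore] -/
theorem algebraMap_d_eq : algebraMap (OC k) (Bc k) (mkC k (X 5)) = -(ψc k (X 2) * ψc k (X 3)) := by
  rw [ψc_X₂, ψc_X₃]
  apply Subtype.ext
  rw [Subalgebra.coe_neg, Subalgebra.coe_mul, blowupAlgebra.coe_frac]
  refine rel_div _ _ _ _ _ (c_mul_invSelf k) ?_
  change algebraMap (OC k) (Localization.Away (trc k 0)) (mkC k (X 5)) * algebraMap (OC k) _ (mkC k (X 1)) =
    -(algebraMap (OC k) _ (mkC k (X 2)) * algebraMap (OC k) _ (mkC k (X 4)))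
  rw [← map_mul (algebraMap (OC k) (Localization.Away (trc k 0))), ← map_mul (algebraMap (OC k) (Localization.Away (trc k 0))),
    ← map_neg (algebraMap (OC k) (Localization.Away (trc k 0))), d_mul_c]

/-- `ȳ₂ = c̄ · t` in `B_c`. [folklore] -/
theorem algebraMap_y₂_eq : algebraMap (OC k) (Bc k) (mkC k (X 4)) = ψc k (X 1) * ψc k (X 3) := by
  rw [ψc_X₁, ψc_X₃]
  apply Subtype.ext
  rw [Subalgebra.coe_mul, blowupAlgebra.coe_frac]
  exact rel_mul _ _ _ (c_mul_invSelf k)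

/-! ## `ψ` is onto -/

/-- Every `x̄ⱼ` lies in the image of `ψ`. [folklore] -/
theorem algebraMap_X_mem_range (j : Fin 6) : algebraMap (OC k) (Bc k) (mkC k (X j)) ∈ (ψc k).range := by
  match j with
  | ⟨0, _⟩ => exact ⟨X 0, ψc_X₀ k⟩
  | ⟨1, _⟩ => exact ⟨X 1, ψc_X₁ k⟩
  | ⟨2, _⟩ => exact ⟨X 2, ψc_X₂ k⟩
  | ⟨3, _⟩ =>
    exact (show algebraMap (OC k) (Bc k) (mkC k (X 3)) ∈ (ψc k).range from
      ⟨-(X 0 * X 3), by rw [map_neg, map_mul, ← algebraMap_x₁_eq]⟩)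
  | ⟨4, _⟩ =>
    exact (show algebraMap (OC k) (Bc k) (mkC k (X 4)) ∈ (ψc k).range from
      ⟨X 1 * X 3, by rw [map_mul, ← algebraMap_y₂_eq]⟩)
  | ⟨5, _⟩ =>
    exact (show algebraMap (OC k) (Bc k) (mkC k (X 5)) ∈ (ψc k).range from
      ⟨-(X 2 * X 3), by rw [map_neg, map_mul, ← algebraMap_d_eq]⟩)

/-- Every constant lies in the image of `ψ`. [folklore] -/
theorem algebraMap_mem_range (y : OC k) : algebraMap (OC k) (Bc k) y ∈ (ψc k).range := by
  obtain ⟨G, rfl⟩ := Ideal.Quotient.mk_surjective y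
  induction G using MvPolynomial.induction_on with
  | C a => exact ⟨C a, ψc_C k a⟩
  | add p q hp hq => rw [map_add, map_add]; exact add_mem hp hq
  | mul_X p j hp => rw [map_mul, map_mul]; exact mul_mem hp (algebraMap_X_mem_range k j)

/-- Every fraction lies in the image of `ψ`. [folklore] -/
theorem frac_mem_range (j : Fin 2) : blowupAlgebra.frac (trc k) 0 j ∈ (ψc k).range := by
  have h0 : blowupAlgebra.frac (trc k) 0 0 ∈ (ψc k).range := by
    refine ⟨1, ?_⟩
    rw [map_one]
    apply Subtype.ext
    rw [blowupAlgebra.coe_frac, OneMemClass.coe_one]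
    exact (c_mul_invSelf k).symm
  match j with
  | ⟨0, _⟩ => exact h0
  | ⟨1, _⟩ => exact ⟨X 3, ψc_X₃ k⟩

/-- **`ψ` is onto.** [folklore] -/
theorem ψc_surjective : Function.Surjective (ψc k) := by
  intro z
  obtain ⟨F, rfl⟩ := blowupAlgebra.eval_surjective (trc k) 0 z
  suffices h : (blowupAlgebra.eval (trc k) 0 F) ∈ (ψc k).range by exact h
  induction F using MvPolynomial.induction_on with
  | C y => rw [blowupAlgebra.eval_C]; exact algebraMap_mem_range k y
  | add p q hp hq => rw [map_add]; exact add_mem hp hq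
  | mul_X p j hp => rw [map_mul, blowupAlgebra.eval_X]; exact mul_mem hp (frac_mem_range k j.1)

/-! ## `ψ` is injective -/

/-- The inverse substitution `x₃ ↦ x₃, c ↦ c, y₁ ↦ y₁, x₁ ↦ −x₃t, y₂ ↦ ct, d ↦ −y₁t`. OURS bookkeeping. -/
def lamValc : Fin 6 → MvPolynomial (Fin 4) k := ![X 0, X 1, X 2, -(X 0 * X 3), X 1 * X 3, -(X 2 * X 3)]

/-- `x₃ ↦ x₃`. [folklore] -/
theorem lamValc_0 : lamValc k 0 = X 0 := rfl
/-- `c ↦ c`. [folklore] -/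
theorem lamValc_1 : lamValc k 1 = X 1 := rfl
/-- `y₁ ↦ y₁`. [folklore] -/
theorem lamValc_2 : lamValc k 2 = X 2 := rfl
/-- `x₁ ↦ −x₃t`. [folklore] -/
theorem lamValc_3 : lamValc k 3 = -(X 0 * X 3) := rfl
/-- `y₂ ↦ ct`. [folklore] -/
theorem lamValc_4 : lamValc k 4 = X 1 * X 3 := rfl
/-- `d ↦ −y₁t`. [folklore] -/
theorem lamValc_5 : lamValc k 5 = -(X 2 * X 3) := rfl

/-- The substitution kills the three minors. [folklore] -/
theorem minors_le_ker : minors k ≤ RingHom.ker (MvPolynomial.eval₂Hom MvPolynomial.C (lamValc k)) := by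
  rw [minors, Ideal.span_le]
  rintro F (rfl | rfl | rfl)
  · rw [SetLike.mem_coe, RingHom.mem_ker, m₁₂]
    simp only [map_add, map_mul, MvPolynomial.eval₂Hom_X', lamValc_0, lamValc_1, lamValc_3, lamValc_4]
    ring
  · rw [SetLike.mem_coe, RingHom.mem_ker, m₁₃]
    simp only [map_sub, map_mul, MvPolynomial.eval₂Hom_X', lamValc_0, lamValc_2, lamValc_3, lamValc_5]
    ring
  · rw [SetLike.mem_coe, RingHom.mem_ker, m₂₃]
    simp only [map_sub, map_neg, map_mul, MvPolynomial.eval₂Hom_X', lamValc_1, lamValc_2, lamValc_4, lamValc_5]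
    ring

/-- `λ : 𝒪_𝒞 → k[x₃,c,y₁,t][1/c]`. OURS bookkeeping. -/
def lamc : OC k →+* Localization.Away (X 1 : MvPolynomial (Fin 4) k) :=
  Ideal.Quotient.lift (minors k)
    ((algebraMap (MvPolynomial (Fin 4) k) (Localization.Away (X 1 : MvPolynomial (Fin 4) k))).comp
      (MvPolynomial.eval₂Hom MvPolynomial.C (lamValc k)))
    (fun a ha => by rw [RingHom.comp_apply, RingHom.mem_ker.mp (minors_le_ker k ha), map_zero])

/-- `λ` on classes. [folklore] -/
theorem lamc_mkC (F : MvPolynomial (Fin 6) k) :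
    lamc k (mkC k F) = algebraMap (MvPolynomial (Fin 4) k) (Localization.Away (X 1 : MvPolynomial (Fin 4) k))
      (MvPolynomial.eval₂Hom MvPolynomial.C (lamValc k) F) :=
  Ideal.Quotient.lift_mk _ _ _

/-- `λ(c̄) = c`. [folklore] -/
theorem lamc_trc_zero : lamc k (trc k 0) =
    algebraMap (MvPolynomial (Fin 4) k) (Localization.Away (X 1 : MvPolynomial (Fin 4) k)) (X 1) := by
  change lamc k (mkC k (X 1)) = _
  rw [lamc_mkC, MvPolynomial.eval₂Hom_X', lamValc_1]

/-- `λ(c̄)` is a unit. [folklore] -/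
theorem isUnit_lamc_trc_zero : IsUnit (lamc k (trc k 0)) := by
  rw [lamc_trc_zero]
  exact IsLocalization.Away.algebraMap_isUnit (X 1 : MvPolynomial (Fin 4) k)

/-- **`Λ : 𝒪_𝒞[1/c̄] → k[x₃,c,y₁,t][1/c]`**, the left inverse of `ψ` after localisation. OURS bookkeeping. -/
def Λc : Localization.Away (trc k 0) →+* Localization.Away (X 1 : MvPolynomial (Fin 4) k) :=
  IsLocalization.Away.lift (trc k 0) (isUnit_lamc_trc_zero k)

/-- `Λ` extends `λ`. [folklore] -/
theorem Λc_algebraMap (y : OC k) : Λc k (algebraMap (OC k) (Localization.Away (trc k 0)) y) = lamc k y :=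
  IsLocalization.Away.lift_eq (trc k 0) (isUnit_lamc_trc_zero k) y

/-- `Λ` on a fraction `r/c̄`: if `λ r = t · λ c̄` then `Λ (r/c̄) = t`. [folklore] -/
theorem Λc_frac {r : OC k} {t : Localization.Away (X 1 : MvPolynomial (Fin 4) k)} (h : lamc k r = t * lamc k (trc k 0)) :
    Λc k (algebraMap (OC k) (Localization.Away (trc k 0)) r * IsLocalization.Away.invSelf (trc k 0)) = t := by
  refine (isUnit_lamc_trc_zero k).mul_left_injective ?_
  dsimp only
  rw [← h, ← Λc_algebraMap k (trc k 0), ← map_mul, mul_assoc, mul_comm (IsLocalization.Away.invSelf (trc k 0)),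
    c_mul_invSelf, mul_one, Λc_algebraMap]

/-- **`Λ ∘ ψ = (k[x₃,c,y₁,t] → k[x₃,c,y₁,t][1/c])`.** [folklore] -/
theorem Λc_comp_ψc :
    (Λc k).comp (((Bc k).val : Bc k →+* Localization.Away (trc k 0)).comp (ψc k)) =
      algebraMap (MvPolynomial (Fin 4) k) (Localization.Away (X 1 : MvPolynomial (Fin 4) k)) := by
  refine MvPolynomial.ringHom_ext (fun a => ?_) (fun j => ?_)
  · rw [RingHom.comp_apply, RingHom.comp_apply, ψc_C]
    change Λc k (algebraMap (OC k) (Localization.Away (trc k 0)) (mkC k (C a))) = _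
    rw [Λc_algebraMap, lamc_mkC, MvPolynomial.eval₂Hom_C]
  · rw [RingHom.comp_apply, RingHom.comp_apply]
    match j with
    | ⟨0, _⟩ =>
      change Λc k ((ψc k (X 0) : Bc k) : Localization.Away (trc k 0)) = algebraMap _ _ (X 0)
      rw [ψc_X₀]
      change Λc k (algebraMap (OC k) (Localization.Away (trc k 0)) (mkC k (X 0))) = _
      rw [Λc_algebraMap, lamc_mkC, MvPolynomial.eval₂Hom_X']
      rfl
    | ⟨1, _⟩ =>
      change Λc k ((ψc k (X 1) : Bc k) : Localization.Away (trc k 0)) = algebraMap _ _ (X 1)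
      rw [ψc_X₁]
      change Λc k (algebraMap (OC k) (Localization.Away (trc k 0)) (mkC k (X 1))) = _
      rw [Λc_algebraMap, lamc_mkC, MvPolynomial.eval₂Hom_X']
      rfl
    | ⟨2, _⟩ =>
      change Λc k ((ψc k (X 2) : Bc k) : Localization.Away (trc k 0)) = algebraMap _ _ (X 2)
      rw [ψc_X₂]
      change Λc k (algebraMap (OC k) (Localization.Away (trc k 0)) (mkC k (X 2))) = _
      rw [Λc_algebraMap, lamc_mkC, MvPolynomial.eval₂Hom_X']
      rfl
    | ⟨3, _⟩ =>
      change Λc k ((ψc k (X 3) : Bc k) : Localization.Away (trc k 0)) = algebraMap _ _ (X 3)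
      rw [ψc_X₃, blowupAlgebra.coe_frac]
      refine Λc_frac k ?_
      change lamc k (mkC k (X 4)) = _
      rw [lamc_trc_zero, lamc_mkC, MvPolynomial.eval₂Hom_X', ← map_mul, lamValc_4, mul_comm]

/-- **`ψ` is injective** (`k` a domain). [folklore] -/
theorem ψc_injective [IsDomain k] : Function.Injective (ψc k) := by
  have hinj : Function.Injective
      (algebraMap (MvPolynomial (Fin 4) k) (Localization.Away (X 1 : MvPolynomial (Fin 4) k))) :=
    IsLocalization.injective _ (powers_le_nonZeroDivisors_of_noZeroDivisors (MvPolynomial.X_ne_zero 1))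
  rw [← Λc_comp_ψc, RingHom.coe_comp, RingHom.coe_comp] at hinj
  exact hinj.of_comp.of_comp

/-! ## Conclusion -/

/-- **K-VERTEX-EXIT, chart `c` (N6.1 (b)(d), model form): `ψ : k[x₃, c, y₁, t] → B_c = 𝒪_𝒞[(c̄,ȳ₂)/c̄]` is a bijection** — the chart
`c ≠ 0` of the blow-up of the determinantal vertex `𝒞 = {rk N ≤ 1}` along the Σ-centre's trace `(c̄, ȳ₂)` is an affine `4`-space, the graph
`x̄₁ = −x̄₃t`, `d̄ = −ȳ₁t`. OURS. -/
theorem ψc_bijective [IsDomain k] : Function.Bijective (ψc k) :=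
  ⟨ψc_injective k, ψc_surjective k⟩

/-- **The chart `B_c` is a regular ring** (over a field): the Σ-touch resolves the K5-vertex on this chart. OURS. -/
theorem isRegularRing_Bc (K : Type u) [Field K] : IsRegularRing (Bc K) :=
  IsRegularRing.of_ringEquiv (RingEquiv.ofBijective (ψc K) (ψc_bijective K))

end VertexExit

end Summit.ResolutionOfSingularities.ResolutionOfSingularities.Cruxes.EquisingularLiftNat.Sections
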